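import Summits.MatrixMultiplication.OmegaCensus.STPPVosperSlackOneTwoWindowsTable

/-!
# ω-census (abelian STPP census): case-β₂ window table `(41, 17)` at `61`, rows `60 ≤ j < 61` (kernel computation)

HONEST FRAMING (pub-omega census; verbatim): lottery ticket; floor = certified bounds/negative ranges.
Census STRUCTURE (seat pub-omega-stpp-1 gen 30, 2026-08-28), family (b2).  One chunk of the `Bool` table `tableBeta2 61 41 17 {0, 1, 60, 31, 30, 41, 20}`
(`STPPVosperSlackOneTwoWindowsTable.lean`), split by the step `j` so that each `decide +kernel` stays small (the kernel evaluates ≈ 0.2 ms per arithmetic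
atom); assembled in `STPPVosperSlackOneKillsB2Z61.lean`.  Pure finite computation; nothing here is progress on `ω`.  Python mirror: HOME `pub-omega-stpp-1-g30/code/beta2_mirror_v6.py`.
-/

open Finset

namespace Summit.MatrixMultiplication.OmegaCensus.CubeNB

set_option maxHeartbeats 4000000 in
/-- Rows `60 ≤ j < 61` of `tableBeta2 61 41 17 {0, 1, 60, 31, 30, 41, 20}`. [folklore] -/
theorem tableBeta2_61_41_17_rows_60_61 : ((List.range' 60 1).all fun j => decide (j ∈ ({0, 1, 60, 31, 30, 41, 20} : Finset ℕ)) || (List.range 61).all fun t =>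
    tableBeta2Core 61 41 17 j t (oddMinL 61 41 17 (posList 61 17 j t)) (posList 61 17 j t)) = true := by
  decide +kernel

end Summit.MatrixMultiplication.OmegaCensus.CubeNB
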